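import Summits.QuantumFields.BalabanUV.T4Continuum.Support.NE7CornerBumpFlatGalerkinLetters
import Summits.QuantumFields.BalabanUV.T4Continuum.Support.NE7CornerBumpFlatLHCIUnique
import Summits.QuantumFields.BalabanUV.T4Continuum.Support.NE7PinnedLandauRepB8
import HarnessLib

/-!
# NE7PinnedLandauRepBumpFlat — «REP WITH A FIXED TOP» AT THE FLAT BACKGROUND, UNCONDITIONAL: the PINNED exactly-Landau representative against the SMOOTH-BUMP
# test class `T^ρ` at `W = 1` — `∃ u, Z` with `U^u = 1·e^{Z}`, `u(M•w) = 1` (THE TOP IS KEPT), `Z` skew periodic and Landau against `T^ρ`, `‖Z‖ ≤ 2r̄`,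
# `‖u − 1‖ ≤ 4c₀M²c_Rb₀` — F89 + F90 with ALL FIVE linear letters DISCHARGED (F96 hI∕hIR, F98 hUniq, F100 hGal, F102 hGalR) and F83's (H0)ₚ at the flat datum; file 34

Cell `pub-balaban`, rung (B)+1 sub-cell t4, lineage `b2b-balaban-t4-ne7-p1` (CRUX PROVER NE7 #1 = OWNER of row NE7), generation 78; memo
`t4/b2b-balaban-t4-ne7-p1-g78/BUMP-CLASS-FLAT.md` §5.  File F103 (over F89 `NE7PinnedLandauRepT`, F90 `NE7PinnedLandauLettersOfLHCI`, F83 `NE7PointedSupRegularity`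
at `W = flatCfg`, and this generation's F96, F98, F100, F102).
WHY (memo §5).  Gen 77 re-founded the representative brick of the curved (APE) as a PETROV–GALERKIN problem (pointed trial, smeared test) and docked it MODULO the
Landau-harmonic corner interpolation of the test class (F90∕F91∕F93); for the block-mean classes that object is a coarse circulant (flat numerics only).  THIS
GENERATION's smooth-bump class `T^ρ` (F96) makes every letter EXPLICIT, and THIS FILE assembles them at the flat background: the pinned (top-preserving) exactly
`T^ρ`-Landau representative EXISTS at `W = 1` for every unitary periodic `U` in the (−1)∕(−2) gauge regime of F89 — a theorem with NO letter left, on every torus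
`N ≥ 1`, every `L ≥ 2` and level `j` with `L^{j+1} ≥ 8`, every `d ≥ 1`.  Constants: `c₁ = 36d²`, `c₀ = 36d³` (F83 at `x = x₁ = 0`), `c_R = c_G(1 + C_I·c₀^G)` with
`c_G = 2 + 576·16^d·64^{2(d−1)}` (F101), `c₀^G = 32d³N²` (F102), `C_I = 96d·256^d` (F96).  The representative is the `W = 1` instance of F92∕F94's input;
at curved `W` the same five letters of `T^ρ_W` remain OPEN (memo §6).
WHAT ([folklore]; 0 def, 0 sorry; profile∕shift∕class by equational hypotheses `hψ`, `hρ`, `hs`, `hT`).  **`exists_pinnedLandauRep_flatCfg_bump`**.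
HONEST FRAMING (page 1): a statement at the TRIVIAL background `W = 1` only; nothing about curved backgrounds; nothing of Bałaban's asserted ([Balaban1985RegularSpaces]
pp. 80–81 replaces the pointed restriction by averaged ones — this pinned representative is the tree's own construct); (APE) on curved data NOT proved; NOT ONE-STEP,
NOT NE7; spine 0∕9; finite T⁴ rung (B)+1 — NOT infinite volume, NOT mass gap, NOT `BetaPertH`, NOT Clay.  Continuum YM on T⁴ ⇐ BetaPertH ∧ nine spine estimates
(0/9 proved); BetaPertH ⇐ (D1) ∧ (D4) ∧ CAP+tail; G-an2-4 gates asym, D1 and NE2/3/4.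
-/

set_option autoImplicit false

open scoped BigOperators Matrix Matrix.Norms.L2Operator
open NormedSpace Finset

namespace Summit.QuantumFields.BalabanUV.T4Continuum.NE7PinnedLandauRepBumpFlat

open Literature.MathematicalPhysics.QuantumFieldTheory.Balaban1983to89
open B7Prop1Explicit B7Prop2Explicit MatrixLog MatrixNorms
open T4AveragingDeficitWall (Ad IsUnitaryCfg IsSkewDir SmallField vary hol_flat)
open T4AveragingDeficitWallBoundary (IsPeriodicCfg periodBox)
open AveragingDeficitPeriodicCounting (IsPeriodicDir)
open AveragingDeficitNearIdentity (Ad_one)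
open NE3EnergyShapes (IsUnitarySite IsPeriodicSite)
open NE3CovariantWeitzenbock (covDiv)
open NE3CovariantCalculus (hsR)
open MinimalActionWitness (flatCfg isPeriodicCfg_flatCfg)
open NE3FlatHessianCurl (isUnitaryCfg_flatCfg smallField_flatCfg_zero)
open NE3.SlicePoincareSlicB8Flat (flatCfg_eq_one)
open SmoothRefineBlocks (blk res)
open BlockAveragePushDirGauge (gaugeDir)
open NE3.PairLandauB8 (covLapSite)
open NE7PointedSupRegularity (supRegularity_pointed)
open NE7PinnedLandauRepT (exists_pinnedLandauRep_W_T_of_supFacts)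
open NE7PinnedLandauLettersOfLHCI (pinnedProj_of_galerkin_lhci pinnedSupLetter_of_galerkin_lhci)
open NE7CornerBumpFlatLHCI (exists_lhci_flatCfg_bump)
open NE7CornerBumpFlatLHCIUnique (lhci_unique_flatCfg_bump)
open NE7CornerBumpFlatGalerkin (galerkin_dir_flatCfg_bump)
open NE7CornerBumpFlatGalerkinLetters (galerkin_letters_flatCfg_bump)

noncomputable section

variable {d : ℕ} {n : Type*} [Fintype n] [DecidableEq n]

/-- **«REP WITH A FIXED TOP» AT THE FLAT BACKGROUND FOR THE SMOOTH-BUMP CLASS, UNCONDITIONAL** (statement in the module docstring): for a unitary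
`(N·M)`-periodic `U` (`M = L^{j+1} ≥ 8`) with `‖U(b) − 1‖ ≤ r₀`, `‖covDiv_1 log U‖ ≤ b₀` and F89's four regime lines at the constants `c₁ = 36d²`, `c₀ = 36d³`,
`c_R = (2 + 576·16^d·64^{2(d−1)})·(1 + 96d·256^d·32d³N²)`, there are a unitary periodic POINTED gauge `u` (`u(M•w) = 1`) and a skew periodic `Z` with
`U^u = vary 1 Z 1`, `Z` Landau against `T^ρ`, `‖U^u − 1‖ ≤ r̄`, `‖Z‖ ≤ 2r̄`, `‖u − 1‖ ≤ 4c₀M²c_Rb₀`, `‖covDiv_1 Z‖ ≤ b₀ + 3c_Rb₀`. [folklore] -/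
theorem exists_pinnedLandauRep_flatCfg_bump [Nonempty n] (hd : 1 ≤ d) {L N : ℕ} [NeZero N] (hL : 2 ≤ L) (j : ℕ) (hM8 : 8 ≤ L ^ (j + 1))
    -- the bump class `T^ρ_1` (profile, shift and class as equational hypotheses)
    {ψ : ℤ → ℝ} (hψ : ∀ t : ℤ, ψ t = if 2 ≤ t ∧ t ≤ ((L ^ (j + 1) : ℕ) : ℤ) - 2 then (((t : ℝ) - 2) * (((L ^ (j + 1) : ℕ) : ℝ) - 2 - t)) ^ 2 else 0)
    {ρ : Site d → ℝ} (hρ : ∀ r, ρ r = ∏ i, ψ (r i)) {s : Site d} (hs : s = fun _ => ((L ^ (j + 1) / 2 : ℕ) : ℤ))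
    (T : (Site d → Matrix n n ℂ) → Prop)
    (hT : ∀ nu : Site d → Matrix n n ℂ, T nu ↔
      ((∀ C : Site d → Matrix n n ℂ, (∀ w, C w ∈ skewAdjoint (Matrix n n ℂ)) → (∀ (w : Site d) (i : Fin d), C (w + (N : ℤ) • e i) = C w) →
          (∀ w : Site d, C ((N : ℤ) • w) = 0) →
          ∑ y ∈ periodBox (d := d) (N * L ^ (j + 1)), hsR ((fun x => ρ (res (L ^ (j + 1)) (x + s)) • C (blk (L ^ (j + 1)) (x + s))) y)
            (covLapSite (flatCfg (d := d) (n := n)) (covLapSite (flatCfg (d := d) (n := n)) nu) y) = 0) ∧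
       (∀ C : Site d → Matrix n n ℂ, (∀ w, C w ∈ skewAdjoint (Matrix n n ℂ)) → (∀ (w : Site d) (i : Fin d), C (w + (N : ℤ) • e i) = C w) →
          (∀ w : Site d, (¬ ∀ i, (N : ℤ) ∣ w i) → C w = 0) →
          ∑ y ∈ periodBox (d := d) (N * L ^ (j + 1)), hsR ((fun x => ρ (res (L ^ (j + 1)) (x + s)) • C (blk (L ^ (j + 1)) (x + s))) y) (nu y) = 0)))
    -- the constants, named
    {c₀ c₁ cG cR : ℝ} (hc₁ : c₁ = 36 * d * (d : ℝ)) (hc₀ : c₀ = 36 * d * (d : ℝ) ^ 2)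
    (hcG : cG = 2 + 576 * (16 : ℝ) ^ d * (64 : ℝ) ^ (2 * (d - 1)))
    (hcR : cR = cG * (1 + (96 * d * (256 : ℝ) ^ d) * (32 * (d : ℝ) ^ 3 * (N : ℝ) ^ 2)))
    -- the field and its initial gauge relative to `1`; F89's regime at these constants
    {U : Site d → Fin d → (Matrix n n ℂ)ˣ} (hUu : IsUnitaryCfg U) (hUP : IsPeriodicCfg U ((N * L ^ (j + 1) : ℕ) : ℤ))
    {r₀ b₀ : ℝ} (hr₀ : ∀ (y : Site d) (μ : Fin d), ‖((((flatCfg (d := d) (n := n)) y μ)⁻¹ * U y μ : (Matrix n n ℂ)ˣ) : (Matrix n n ℂ)) - 1‖ ≤ r₀)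
    (hb₀ : ∀ x : Site d, ‖covDiv (flatCfg (d := d) (n := n)) (fun y μ => mlog ((((flatCfg (d := d) (n := n)) y μ)⁻¹ * U y μ : (Matrix n n ℂ)ˣ) : (Matrix n n ℂ))) x‖ ≤ b₀)
    (hreg₁ : c₀ * ((L : ℝ) ^ (j + 1)) ^ 2 * (cR * b₀) ≤ 1 / 10) (hreg₂ : c₁ * (L : ℝ) ^ (j + 1) * (cR * b₀) ≤ 1 / 25)
    (hreg₃ : r₀ + 5 / 2 * (c₁ * (L : ℝ) ^ (j + 1) * (cR * b₀)) ≤ 1 / 20)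
    (hline : cR * (4 * (c₀ * ((L : ℝ) ^ (j + 1)) ^ 2) * (b₀ + 4 * (cR * b₀))
        + 25 * d * (r₀ + 5 / 2 * (c₁ * (L : ℝ) ^ (j + 1) * (cR * b₀))) * (c₁ * (L : ℝ) ^ (j + 1))
        + 14 * d * (c₁ * (L : ℝ) ^ (j + 1)) ^ 2 * (cR * b₀)) ≤ 1 / 2) :
    ∃ (u : Site d → (Matrix n n ℂ)ˣ) (Z : Site d → Fin d → (Matrix n n ℂ)),
      IsUnitarySite u ∧ IsPeriodicSite u ((N * L ^ (j + 1) : ℕ) : ℤ) ∧ IsSkewDir Z ∧ IsPeriodicDir Z ((N * L ^ (j + 1) : ℕ) : ℤ) ∧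
      gaugeAct u U = vary (flatCfg (d := d) (n := n)) Z 1 ∧ (∀ w : Site d, u ((((L ^ (j + 1) : ℕ) : ℤ)) • w) = 1) ∧
      (∀ nu : Site d → Matrix n n ℂ, (∀ y, nu y ∈ skewAdjoint (Matrix n n ℂ)) →
          (∀ (y : Site d) (i : Fin d), nu (y + ((N * L ^ (j + 1) : ℕ) : ℤ) • e i) = nu y) → T nu →
        ∑ y ∈ periodBox (d := d) (N * L ^ (j + 1)), ∑ κ : Fin d,
          hsR (Z y κ) (gaugeDir (flatCfg (d := d) (n := n)) (covLapSite (flatCfg (d := d) (n := n)) nu) y κ) = 0) ∧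
      (∀ (y : Site d) (μ : Fin d), ‖((((flatCfg (d := d) (n := n)) y μ)⁻¹ * gaugeAct u U y μ : (Matrix n n ℂ)ˣ) : (Matrix n n ℂ)) - 1‖
          ≤ r₀ + 5 / 2 * (c₁ * (L : ℝ) ^ (j + 1) * (cR * b₀))) ∧
      (∀ (y : Site d) (μ : Fin d), ‖Z y μ‖ ≤ 2 * (r₀ + 5 / 2 * (c₁ * (L : ℝ) ^ (j + 1) * (cR * b₀)))) ∧
      (∀ y : Site d, ‖((u y : (Matrix n n ℂ)ˣ) : (Matrix n n ℂ)) - 1‖ ≤ 4 * (c₀ * ((L : ℝ) ^ (j + 1)) ^ 2 * (cR * b₀))) ∧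
      (∀ x : Site d, ‖covDiv (flatCfg (d := d) (n := n)) Z x‖ ≤ b₀ + 3 * (cR * b₀)) := by
  have hL1 : 1 ≤ L := by omega
  have hN : 1 ≤ N := Nat.one_le_iff_ne_zero.mpr (NeZero.ne N)
  set M : ℕ := L ^ (j + 1) with hMdef
  have hP : 1 ≤ N * M := Nat.mul_pos (by omega) (by omega)
  have hMr : ((M : ℕ) : ℝ) = (L : ℝ) ^ (j + 1) := by rw [hMdef]; push_cast; ring
  have hWu : IsUnitaryCfg (flatCfg (d := d) (n := n)) := isUnitaryCfg_flatCfg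
  have hWP : IsPeriodicCfg (flatCfg (d := d) (n := n)) ((N * M : ℕ) : ℤ) := isPeriodicCfg_flatCfg _
  have hc₀0 : 0 ≤ c₀ := by rw [hc₀]; positivity
  have hc₁0 : 0 ≤ c₁ := by rw [hc₁]; positivity
  have hcG1 : 1 ≤ cG := by
    rw [hcG]; have : 0 ≤ 576 * (16 : ℝ) ^ d * (64 : ℝ) ^ (2 * (d - 1)) := by positivity
    linarith
  have hcR1 : 1 ≤ cR := by
    rw [hcR]
    have h1 : (1 : ℝ) ≤ 1 + (96 * d * (256 : ℝ) ^ d) * (32 * (d : ℝ) ^ 3 * (N : ℝ) ^ 2) := by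
      have : 0 ≤ (96 * d * (256 : ℝ) ^ d) * (32 * (d : ℝ) ^ 3 * (N : ℝ) ^ 2) := by positivity
      linarith
    nlinarith
  -- hG: F83 at the flat datum (`x = x₁ = 0`)
  have hgrad : ∀ (p : Site d) (μ κ : Fin d), κ ≠ μ →
      ‖Ad ((flatCfg (d := d) (n := n)) p μ) ((hol (flatCfg (d := d) (n := n)) (p + e μ) (plaqWord κ μ) : (Matrix n n ℂ)ˣ) : Matrix n n ℂ)
        - ((hol (flatCfg (d := d) (n := n)) p (plaqWord κ μ) : (Matrix n n ℂ)ˣ) : Matrix n n ℂ)‖ ≤ 0 := by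
    intro p μ κ _
    have hf : (flatCfg (d := d) (n := n)) = fun _ _ => 1 := rfl
    rw [hf, hol_flat, hol_flat]
    simp [Ad_one]
  have hbx : 23040 * (d : ℝ) ^ 4 * (d : ℝ) ^ 2 * ((L : ℝ) ^ (j + 1)) ^ 2 * 0 ≤ 1 := by norm_num
  have hcx : 11520 * (d : ℝ) ^ 4 * (d : ℝ) ^ 3 * ((L : ℝ) ^ (j + 1)) ^ 3 * 0 ≤ 1 := by norm_num
  have hG : ∀ mu : Site d → Matrix n n ℂ, ((∀ y, mu y ∈ skewAdjoint (Matrix n n ℂ)) ∧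
      (∀ (y : Site d) (i : Fin d), mu (y + ((N * L ^ (j + 1) : ℕ) : ℤ) • e i) = mu y) ∧ (∀ w : Site d, mu ((((L ^ (j + 1) : ℕ) : ℤ)) • w) = 0)) →
      ∀ B : ℝ, (∀ y : Site d, ‖covLapSite (flatCfg (d := d) (n := n)) mu y‖ ≤ B) →
        (∀ y : Site d, ‖mu y‖ ≤ c₀ * ((L : ℝ) ^ (j + 1)) ^ 2 * B) ∧
        (∀ (y : Site d) (μ : Fin d), ‖gaugeDir (flatCfg (d := d) (n := n)) mu y μ‖ ≤ c₁ * (L : ℝ) ^ (j + 1) * B) := by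
    intro mu hmu B hB
    obtain ⟨hD, hS⟩ := supRegularity_pointed hd hL j hWu hWP le_rfl smallField_flatCfg_zero le_rfl hgrad hbx hcx hmu.2.1 hmu.2.2 hB
    refine ⟨fun y => (hS y).trans (le_of_eq ?_), fun y μ => (hD y μ).trans (le_of_eq ?_)⟩
    · rw [hc₀]
    · rw [hc₁]
  -- the class's clause (i), one-directional (for F96)
  have hTi : ∀ nu : Site d → Matrix n n ℂ, T nu → ∀ C : Site d → Matrix n n ℂ, (∀ w, C w ∈ skewAdjoint (Matrix n n ℂ)) →
      (∀ (w : Site d) (i : Fin d), C (w + (N : ℤ) • e i) = C w) → (∀ w : Site d, C ((N : ℤ) • w) = 0) →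
      ∑ y ∈ periodBox (d := d) (N * M), hsR ((fun x => ρ (res M (x + s)) • C (blk M (x + s))) y)
        (covLapSite (flatCfg (d := d) (n := n)) (covLapSite (flatCfg (d := d) (n := n)) nu) y) = 0 :=
    fun nu hnu => ((hT nu).mp hnu).1
  -- hProj: F90 §2 from F100 (`hGal`) and F96 (LHCI existence)
  have hGal' := galerkin_dir_flatCfg_bump (n := n) hM8 hN hψ hρ s T hT
  have hGal : ∀ Y : Site d → Fin d → Matrix n n ℂ, ∃ lam₁ : Site d → Matrix n n ℂ,
      (∀ y, lam₁ y ∈ skewAdjoint (Matrix n n ℂ)) ∧ (∀ (y : Site d) (i : Fin d), lam₁ (y + ((N * M : ℕ) : ℤ) • e i) = lam₁ y) ∧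
      (∀ nu : Site d → Matrix n n ℂ, (∀ y, nu y ∈ skewAdjoint (Matrix n n ℂ)) →
          (∀ (y : Site d) (i : Fin d), nu (y + ((N * M : ℕ) : ℤ) • e i) = nu y) → T nu →
        ∑ y ∈ periodBox (d := d) (N * M), ∑ κ : Fin d,
          hsR (Y y κ + gaugeDir (flatCfg (d := d) (n := n)) lam₁ y κ) (gaugeDir (flatCfg (d := d) (n := n)) (covLapSite (flatCfg (d := d) (n := n)) nu) y κ) = 0) := by
    intro Y
    obtain ⟨lam₁, h1, h2, -, h3⟩ := hGal' Y
    exact ⟨lam₁, h1, h2, h3⟩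
  have hIfull := exists_lhci_flatCfg_bump (n := n) hd hM8 hN hψ hρ hs T hTi
  have hIex : ∀ a : Site d → Matrix n n ℂ, (∀ w, a w ∈ skewAdjoint (Matrix n n ℂ)) → (∀ (w : Site d) (i : Fin d), a (w + (N : ℤ) • e i) = a w) →
      ∃ eta : Site d → Matrix n n ℂ,
        (∀ y, eta y ∈ skewAdjoint (Matrix n n ℂ)) ∧ (∀ (y : Site d) (i : Fin d), eta (y + ((N * M : ℕ) : ℤ) • e i) = eta y) ∧
        (∀ w : Site d, eta (((M : ℕ) : ℤ) • w) = a w) ∧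
        (∀ nu : Site d → Matrix n n ℂ, (∀ y, nu y ∈ skewAdjoint (Matrix n n ℂ)) →
            (∀ (y : Site d) (i : Fin d), nu (y + ((N * M : ℕ) : ℤ) • e i) = nu y) → T nu →
          ∑ y ∈ periodBox (d := d) (N * M), ∑ κ : Fin d,
            hsR (gaugeDir (flatCfg (d := d) (n := n)) eta y κ) (gaugeDir (flatCfg (d := d) (n := n)) (covLapSite (flatCfg (d := d) (n := n)) nu) y κ) = 0) := by
    intro a has haP
    obtain ⟨eta, hes, heP, he0, heL, -⟩ := hIfull a has haP
    exact ⟨eta, hes, heP, he0, heL⟩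
  have hProj := pinnedProj_of_galerkin_lhci (d := d) (n := n) (L := L) (N := N) j T (W := flatCfg (d := d) (n := n)) hGal hIex
  -- hR: F90 §3 from F102 (`hGalR`), F96 with its bound (`hIR`), F98 (`hUniq`)
  have hGalR' := galerkin_letters_flatCfg_bump (n := n) hd hM8 hN hψ hρ hs T hT
  have hGalR : ∀ F : Site d → Matrix n n ℂ, (∀ y, F y ∈ skewAdjoint (Matrix n n ℂ)) →
      (∀ (y : Site d) (i : Fin d), F (y + ((N * M : ℕ) : ℤ) • e i) = F y) →
      ∃ lam₁ : Site d → Matrix n n ℂ,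
        (∀ y, lam₁ y ∈ skewAdjoint (Matrix n n ℂ)) ∧ (∀ (y : Site d) (i : Fin d), lam₁ (y + ((N * M : ℕ) : ℤ) • e i) = lam₁ y) ∧
        (∀ nu : Site d → Matrix n n ℂ, (∀ y, nu y ∈ skewAdjoint (Matrix n n ℂ)) →
            (∀ (y : Site d) (i : Fin d), nu (y + ((N * M : ℕ) : ℤ) • e i) = nu y) → T nu →
          ∑ y ∈ periodBox (d := d) (N * M), hsR (F y + covLapSite (flatCfg (d := d) (n := n)) lam₁ y) (covLapSite (flatCfg (d := d) (n := n)) nu y) = 0) ∧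
        ∀ B : ℝ, (∀ y, ‖F y‖ ≤ B) →
          (∀ y, ‖covLapSite (flatCfg (d := d) (n := n)) lam₁ y‖ ≤ cG * B) ∧
          (∀ y, ‖lam₁ y‖ ≤ (32 * (d : ℝ) ^ 3 * (N : ℝ) ^ 2) * ((L : ℝ) ^ (j + 1)) ^ 2 * (cG * B)) := by
    intro F hFs hFP
    obtain ⟨lam₁, hls, hlP, horth, hbd⟩ := hGalR' F hFs hFP
    refine ⟨lam₁, hls, hlP, horth, fun B hB => ?_⟩
    obtain ⟨h1, h2⟩ := hbd B hB
    rw [hcG, ← hMr]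
    exact ⟨h1, h2⟩
  have hIR : ∀ a : Site d → Matrix n n ℂ, (∀ w, a w ∈ skewAdjoint (Matrix n n ℂ)) → (∀ (w : Site d) (i : Fin d), a (w + (N : ℤ) • e i) = a w) →
      ∃ eta : Site d → Matrix n n ℂ,
        (∀ y, eta y ∈ skewAdjoint (Matrix n n ℂ)) ∧ (∀ (y : Site d) (i : Fin d), eta (y + ((N * M : ℕ) : ℤ) • e i) = eta y) ∧
        (∀ w : Site d, eta (((M : ℕ) : ℤ) • w) = a w) ∧
        (∀ nu : Site d → Matrix n n ℂ, (∀ y, nu y ∈ skewAdjoint (Matrix n n ℂ)) →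
            (∀ (y : Site d) (i : Fin d), nu (y + ((N * M : ℕ) : ℤ) • e i) = nu y) → T nu →
          ∑ y ∈ periodBox (d := d) (N * M), ∑ κ : Fin d,
            hsR (gaugeDir (flatCfg (d := d) (n := n)) eta y κ) (gaugeDir (flatCfg (d := d) (n := n)) (covLapSite (flatCfg (d := d) (n := n)) nu) y κ) = 0) ∧
        ∀ A : ℝ, (∀ w, ‖a w‖ ≤ A) → ∀ y, ‖covLapSite (flatCfg (d := d) (n := n)) eta y‖ ≤ (96 * d * (256 : ℝ) ^ d) / ((L : ℝ) ^ (j + 1)) ^ 2 * A := by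
    intro a has haP
    obtain ⟨eta, hes, heP, he0, heL, heB⟩ := hIfull a has haP
    refine ⟨eta, hes, heP, he0, heL, fun A hA y => ?_⟩
    rw [← hMr]; exact heB A hA y
  have hUniq := lhci_unique_flatCfg_bump (n := n) hM8 hN hψ hρ hs T hT
  have hR' := pinnedSupLetter_of_galerkin_lhci (d := d) (n := n) (L := L) (N := N) j hP T hWu hWP
    (c₀ := 32 * (d : ℝ) ^ 3 * (N : ℝ) ^ 2) (cR := cG) (CI := 96 * d * (256 : ℝ) ^ d) hGalR hIR hUniq
  have hR : ∀ (F : Site d → Matrix n n ℂ), (∀ y : Site d, F y ∈ skewAdjoint (Matrix n n ℂ)) →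
      (∀ (y : Site d) (i : Fin d), F (y + ((N * L ^ (j + 1) : ℕ) : ℤ) • e i) = F y) →
      ∀ mu : Site d → Matrix n n ℂ, ((∀ y, mu y ∈ skewAdjoint (Matrix n n ℂ)) ∧
        (∀ (y : Site d) (i : Fin d), mu (y + ((N * L ^ (j + 1) : ℕ) : ℤ) • e i) = mu y) ∧ (∀ w : Site d, mu ((((L ^ (j + 1) : ℕ) : ℤ)) • w) = 0)) →
        (∀ nu : Site d → Matrix n n ℂ, (∀ y, nu y ∈ skewAdjoint (Matrix n n ℂ)) →
          (∀ (y : Site d) (i : Fin d), nu (y + ((N * L ^ (j + 1) : ℕ) : ℤ) • e i) = nu y) → T nu →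
          ∑ y ∈ periodBox (d := d) (N * L ^ (j + 1)), hsR (F y + covLapSite (flatCfg (d := d) (n := n)) mu y) (covLapSite (flatCfg (d := d) (n := n)) nu y) = 0) →
        ∀ B : ℝ, (∀ y : Site d, ‖F y‖ ≤ B) → ∀ y : Site d, ‖covLapSite (flatCfg (d := d) (n := n)) mu y‖ ≤ cR * B := by
    intro F hFs hFP mu hmu horth B hFB y
    have h := hR' F hFs hFP mu hmu horth B hFB y
    rw [hcR]
    linarith
  -- F89 with `W = 1`, `T = T^ρ`
  exact exists_pinnedLandauRep_W_T_of_supFacts hd hL hN j T hc₀0 hc₁0 hcR1 hWu hWP hG hR hProj hUu hUP hr₀ hb₀ hreg₁ hreg₂ hreg₃ hline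

end

end Summit.QuantumFields.BalabanUV.T4Continuum.NE7PinnedLandauRepBumpFlat
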